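import Summits.BirchSwinnertonDyer.Rank1Residual.F1Sign2.TranspositionDoorAtTwo
import Summits.BirchSwinnertonDyer.Rank1Residual.F1Sign2.TwistSelmerRelaxedAtInfinityAtTwo
import HarnessLib

/-!
# Cell `bsd-f1-sign2`, lens `-an` g9 (MEMO-an v1.19 §2 AN-26/AN-27): «THE TWO-TRANSPOSITION DOOR AT `Δ > 0`, `ε = −1`» —
# T-2q `TwoTranspositionTwistLawAtTwo`, the bit law, the supply, AN-26 `TwoTranspositionIndexLawAtTwo`, the twist value law

TEXT-ONLY FOLLOW-UP (-ty g7, after REF2-PLACEMENT-v17 §9.1, 2026-08-28T06:06:10Z): cite tags on `TwoTranspAdmissible`, T-2q, the bit law and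
AN-26 corrected — Mazur–Rubin 2010 Prop 3.3 (= arXiv Prop. 28) is cited for the METHOD only (its real-place clause fails for d < 0; the count is
re-derived from Lemma 3.2 at T = {∞, q₀, q₁}), and Klagsbrun–Mazur–Rubin 2014 Prop. 47 (ii) / Rem. 50 (the known-assembly source per REF2 v17 §5; bib
key `KlagsbrunMazurRubin2014` added) is cited; declarations UNCHANGED.

STATEMENTS ONLY + PROVED bookkeeping: carriers `TwoTranspAdmissible`, `OnIdLocus`, `twistCondAbove` (defs with bodies); T-2q
`TwoTranspositionTwistLawAtTwo`, `TwoTranspositionBitLawAtTwo`, `TwoTranspositionSupplyAtTwo` as plain `def … : Prop` (THEOREMS ON PAPER per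
the planner — in-print assemblies MR 2010 §3 + Poonen–Rains 2012 + KMR 2013 resp. MR Lemma 3.5 + Chebotarev; nothing asserted); AN-26
`TwoTranspositionIndexLawAtTwo` as `@[conjecture] def` (the lens's BSD₂-shadow at `ε = −1`, OPEN); the twist value law
`TwoTranspositionTwistValueAtTwo` as `@[conjecture] def` (typer edit, cell convention: the planner marks it «OPEN IN PRINT» — the 2-part of BSD for a rank-0 twist with two additive `I₀*` primes; nothing asserted); two proved
trivialities (`twoTranspAdmissible_neg`, `not_trivial_of_closed`). No named Literature fact, no `sorry`, no `instance`.

TYPER FILING (seat `bsd-f1-sign2-ty` g7; D-an-33; CANDIDATES.md rows T-2q / AN-26-BIT / AN-26-SUP / **AN-26** / AN-26-VAL from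
`MEMO-an-data/g9/CANDIDATES-rows-an-v119.md` a46424a617b85e11): bodies VERBATIM from the planner's `HOME/MEMO-an-data/g9/Sketch_v15.lean`
**983a66d29fe3ad2c** (-an g9 2026-08-28T03:37:12Z; MEMO-an.md v1.19.1 132a75b361e26af2 §2 AN-26; `lean check` rc 0 · 0 warn · 0 sorry per -an; BC7
`Sketch_v15_probe.verdicts.txt` 5/5 CLEAN; evidence #41–#44 on stmt-BirchSwinnertonDyer-23715), namespace `…F1Sign2.TwoDoor` as in the sketch (sibling
of `…F1Sign2.TranspositionDoor` / `…F1Sign2.SingleDoor`); typer edits = this header, the `@[conjecture]` tag on the value law, bib key `CaiLiZhai2020` ↦ `CaiLiZhai2019` (the tree's key for JLMS 101 (2020), doi 10.1112/jlms.12284). CENSUS of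
record (planner's, quoted; kit tag `bsd-frontier-data`): ENGINE J **j298065** full (N < 6·10⁴; 24 156 Δ > 0 rank-1 odd-torsion #1 curves, 5 293 with
ε = −1 ∧ Ш_an odd, 212 929 two-transposition twists; P26.1–P26.5 pre-registered): **MR bound 0/212 929 violations; T-2q bit system consistent
5 293/5 293 curves with 176 403 redundant 𝔽₂-predictions met, 0 failed; twin engine 3 043/3 043; slice supply 1 339/1 339; tranche V: Sel₂-trivial ⇒
r_an(E^(d)) = 0 ∧ Ш_an(E^(d)) ∈ {1,9,25,49,81} on 1 591/1 591, v₂Tam(E^(d)) = v₂Tam(E) + 2 on 3 794/3 794**; ENGINE K j298313 (60 slice rows,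
P26.4 pre-registered «v₂ I_K = 1»): **46/46 certified rows v₂ I_K = 1** (I_K ∈ {2, 6, 10, 18, 22, 30, 78}), P-22 46/46; ENGINE K2 j298464: 259/259
certified slice rows v₂ I_K = 1, Tam-even 168/168 v₂ I_K = 1 + v₂ Tam (-an g9 DONE 03:57:07Z). The row docstrings below quote the PILOT j297987
numbers as the planner wrote them; the full-run numbers above supersede them. REF1-AUDIT-v1 §69 (2026-08-28T05:15:12Z, file 5581b31f40e7cbd1; evidence `HOME/REF1-data/b69/`: Probe_V15.lean rc 0, 6 sorries = the probe anchors, 193.4 s; BC7_b69.txt; cmpdecls_v6.txt; sqdisc_scan_N60000.txt; ENGINE W kit j299065 pending → §69 add.): **T-2q `TwoTranspositionTwistLawAtTwo` SURVIVES theorem-grade by in-print assembly** (Mazur–Rubin 2010 Def 3.1 / Lemma 3.2 [arXiv:0904.3709 p. 8, «Lemma 27»: dim Sᵀ − dim S_T = Σ_{v∈T} dim H¹_f(K_v, E[2])] at T = {∞, q₀, q₁} — deliberately NOT Prop 3.3, whose printed real-place hypothesis the d < 0, Δ > 0 case violates — + Poonen–Rains 2012 Thm 4.14 / Prop 4.11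 + KMR 2013 §3 + Monsky 1996; BC7 CLEAN P1 23.9 s / P2 5.8 / P2h 6.3 / P3 9.3; vacuous but true on square Δ, kernel `T2q_vacuous_on_square`); **`TwoTranspositionBitLawAtTwo` SURVIVES** (∃-corollary of T-2q; BC7 CLEAN); **AN-26 `TwoTranspositionIndexLawAtTwo` SURVIVES conjecture-grade** (`@[conjecture]` correct; typing «v₂ I_K = 1» faithful; `¬ 2 ∣ Tam` load-bearing — the Tam-even corner obeys 1 + v₂ Tam, ENGINE K2 168/168; BC7 CLEAN P1 16.0 / P2 6.0 / P2h 6.2 / P3 11.8); **`TwoTranspositionTwistValueAtTwo` SURVIVES conjecture-grade** (open in print at 2; BC7 CLEAN) ⇒ `@[conjecture]` (typer); **`TwoTranspositionSupplyAtTwo` KILLED AS TYPED = refuted-misstated** (kernel `REF1b69.not_isSquare_of_supply`; 86 square-Δ ε = −1 rank-1 Ш_an-odd Cremona witnesses N < 6·10⁴, simplest 6156e1) and **REPAIRED as C′ = `¬ IsSquare W.Δ →` inserted after `0 < W.Δ →`** (= MR10 Lemma 3.5's printed «Gal(M/K) ≅ S₃»; witnesses miss C′; C′ SURVIVES theorem-grade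 on paper via MR10 L3.5/3.6 + Chebotarev; BC7 CLEAN P1 11.1 / P2 4.7 / P2h 2.3) — FILED HERE IN THE REPAIRED FORM under the same name (REF1: «name it …SupplyAtTwo with the S₃ binder, not a second decl»; the planner's text says «S₃» — evident intent), on notice to -an g10. Mutation (A5): T-2q's `ShaTwoTrivial` / `mordellWeilRank = 1` / `NoRationalTwoTorsion` / `0 < Δ` all load-bearing. Side observation recorded by REF1 for -an, -desc: among 466 square-Δ rank-1 odd-torsion curves N < 6·10⁴ the cross-table (ε, Tam mod 2) has (−1, odd) = 0 (candidate lemma «C₃ image ∧ Tam odd ∧ rank 1 ∧ Ш[2] = 0 ⇒ ε = +1»). REF2-PLACEMENT-v17 §5 (B) (HOME/REF2-PLACEMENT-v17.md 0739e38c2d0f99ed, 2026-08-28T05:32:12Z): **T-2q = KNOWN-ASSEMBLY**, derivable in one page — KMR 2014 Prop. 47(ii) (arXiv:1303.6507 numbering; p = 2 ⟺ S₃, Rem. 50; Σ ∋ ∞ so the sign-at-∞ twist is twisting data) applied at q₀ then q₁, starting from Sel(E[2], ω̄) = Sel₂^{rel ∞}(E) = ⟨δP₀, c_∞⟩ (MR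 2010 Lemma 3.2 at T = {∞}, stated for PLACES, arXiv:0904.3709 p0008 L7–45 — so D-an-34 (a) IS IN PRINT) + PR 2012 isotropy at ℝ; the bilinear bit law is the explicit second step t(q₁) (proof of Prop. 47, p0017 L100–115) — correct, printed nowhere as a sentence; NOT an instance of MR Prop. 3.3 (its «real places with Δ > 0 split» clause fails for d < 0; moving ∞ into T is the right fix). BitLaw = corollary. **Supply = IN-PRINT ASSEMBLY** (MR L.3.5 verbatim [p0008 L176–186] + Chebotarev; KMR Prop. 53 densities). **IndexLaw (AN-26) = CONJECTURE, OPEN IN PRINT, new-combination agreed**: lower half (Ш(E/K)[2] ⊇ (ℤ/2)² ⇒ 2 ∣ I_K under BSD) = Kramer 1981 Thm 1 + GZ; exactness = 2-part of the GZ–BSD index identity, p = 2 excluded from every printed p-part result (Kriz–Li 2019 Rem. 1.14); no 2-adic Heegner-index law with a_q-EVEN ramified primes for non-CM E(ℚ)[2] = 0 anywhere (Kriz–Li a_ℓ odd; Tian/TYZ/LTYZ CM; CLTZ/CLZ rational 2-torsion; Smith 2025 statistical). **TwistValue: OPEN as an equality; nearest print IN the regime = Zhai 2021 (PAMQ 2025)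 Thm 1.1 [arXiv:2102.11798 p0003 L25–31]: ord₂(L(E^{(d)},1)/c_∞(E^{(d)})) ≥ t_E(d) − 1 − ord₂ν_E = 1 here** (t_E(d) = 2: c_q = 2 exactly at the two transposition primes; d < 0 allowed; E optimal, 4 ∤ N ⇒ ν_E odd) vs the BSD-predicted v₂Tam(E) + 2 ≥ 2; typing guard «¬ 2 ∣ Dt.c» suffices. Refuted in print: nothing. PARTITION: none moved; beyond-print theorem: no (T-2q / supply print-derivable, not kernel-proved; AN-26 conjecture with a 46 + 259 + 1 591-row witness).
bears_on: `stmt-BirchSwinnertonDyer-23715` (line `egg_kolyvagin_two` v6 «three doors»: the ε = −1 door; residual on the slice = Ш(E)[2] ≠ 0 only).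

Planner's summary (verbatim):
# Sketch v15 (-an g9, MEMO-an v1.19 §2 AN-26/AN-27): THE TWO-TRANSPOSITION DOOR AT `Δ > 0`, `ε = −1`

The line `egg_kolyvagin_two` (crux `RankOneAtTwoBigImageOddLocal`) had NO PLAN on `{Δ > 0, E(ℚ) ⊂ E⁰(ℝ)}` (`ε = −1`):
the door at `∞` is shut, and by Hilbert reciprocity (AN-22J) a Heegner `d ≡ 1 (8)` carries an EVEN number of transposition
primes, so there is no single finite door either; every admissible Heegner index is even (census 1 600/1 600).
This sketch opens the corner with TWO transposition primes `q₀, q₁ ∣ d_K` (`T = {∞, q₀, q₁}` in Mazur–Rubin 2010 §3).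

THE NEW OBJECT is the ∞-relaxed Selmer group `R = Sel₂^{rel ∞}(E)` (tree `selmerGroupRelaxedAtInfinityAtTwo`): by Poitou–Tate
at `T = {∞}` (MR Lemma 3.2) `dim R = dim Sel₂(E) + [res_∞ Sel₂(E) = 0]`, so for rank one, `Ш[2] = 0`, `E(ℚ)[2] = 0`:
`R = ⟨δP₀⟩` at `ε = +1` and `R = ⟨δP₀, c_∞⟩` at `ε = −1`, `c_∞` = the class of the (canonical up to `δP₀`) `2`-covering of `E`
soluble at every finite place and insoluble at `ℝ` (= -desc's «extra Selmer class of every admissible twist», DESC-§17-R).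
Door bits `p_q := [loc_q δP₀ ≠ 0] = [P̃₀ ∉ 2Ẽ(𝔽_q)]` (= `MeetsNonNormAt W q`) and NEW bits `b_q := [loc_q c_∞ ≠ 0]`
(defined modulo `b ↦ b + p`) at transposition primes `q`.

* T-2q `TwoTranspositionTwistLawAtTwo` (THEOREM on paper; in-print assembly: MR 2010 Def 3.1–Prop 3.3 + Lemma 2.10/2.11
  transversality at a ramified `q` with `E(ℚ_q)[2] ≅ ℤ/2`; Poonen–Rains 2012 Thm 4.14 + Prop 4.11 (the images of global classes
  and the local conditions are maximal isotropic for the QUADRATIC form `⊕_v q_v` on `⊕_{v∈T} H¹(ℚ_v, E[2])`); Klagsbrun–Mazur–Rubin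
  2013 (the twisted local condition `H¹_f(ℚ_v, E^D[2])` is Lagrangian for the SAME `q_v`); root number `w(E^D) = +1`):
  for `(d, q₀, q₁)` two-transposition-admissible, a door open at `q₀` or `q₁`: `#Sel₂(E^{(d)}) ∈ {1, 4}` and
  `Sel₂(E^{(d)}) = 0 ⟺ R ∩ (twisted conditions above q₀, q₁) = 0 ⟺ p_{q₀} b_{q₁} + p_{q₁} b_{q₀} = 1`;
  both doors closed: `Sel₂(E) ⊆ Sel₂(E^{(d)})`, `#Sel₂(E^{(d)}) ∈ {4, 16}`.  (The quadratic refinement is load-bearing: with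
  bilinear Lagrangians only, 105 of the 135 maximal isotropic 3-spaces of `𝔽₂⁶` are not totally singular and the criterion fails.)
* `TwoTranspositionBitLawAtTwo` — the elementary shadow the census tests: ONE bit-function `b` per curve predicts
  `Sel₂`-triviality of every two-transposition twist (an `𝔽₂`-linear system of rank `#T₁ − 1`; every further twist is a prediction).
* `TwoTranspositionSupplyAtTwo` (THEOREM on paper: MR 2010 Lemma 3.5 — Frobenius prescribed simultaneously in `M K^{ab}`
  (`M = ℚ(E[2])`; residues mod `8` and mod odd bad `ℓ`) and on the two independent classes `δP₀, c_∞` — + Chebotarev + T-2q):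
  at `ε = −1` there IS an imaginary quadratic Heegner field with `Sel₂(E^{(d_K)}) = 0` (two transposition primes, `(d_K, N) = 1`).
* AN-26 `TwoTranspositionIndexLawAtTwo` (CONJECTURE of this lens = BSD₂-shadow at `ε = −1` through the tree door
  `P2.bsdp_two_iff_of_heegner_rankOne` with `n_∞ = 2`, `k = 1`, `w_K = 2`, `v₂ q_d = v₂ ∏c_ℓ + 2`): on the slice, for such `K`
  with `Sel₂(E^{(d_K)}) = 0` and an odd-constant parametrisation, the Heegner point is TWICE a point that is not twice, up to
  torsion (`v₂ I_K = 1` exactly; `Ш(E/K)[2] ≅ (ℤ/2)²` by Kramer 1981 Thm 1, matched by `I_K² = 4·odd`).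
* `TwoTranspositionTwistValueAtTwo` (2-part of BSD for the rank-0 `Sel₂`-trivial twist with TWO additive `I₀*` primes of
  `c_q = 2`: `v₂(L(E^{(d)},1)/Ω) = v₂ ∏c_ℓ(E) + 2`; open in print as S4⁻).
Census ENGINE J (kit j297987 pilot / j298065 full, pre-registered P26.1–P26.5).  Nothing is asserted: `def … : Prop` only,
one `@[conjecture] def`, two proved trivialities.
LANDING NOTE (-ty g12, 2026-08-28T20:2xZ): T-2q's COUNTING clauses (a).1 + (b) are TREE THEOREMS — `GenusKolyTransp.twoTranspositionTwistLaw_card` (gk2-p4 g13, p662416); the quadratic iff of (a) is open; see the T-2q docstring.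
LANDING NOTE (-ty g13, 2026-08-28T22:4xZ; text only, statements untouched): **`TwoTranspositionBitLawAtTwo` IS NOW A TREE THEOREM** —
`Summit.BirchSwinnertonDyer.BirchSwinnertonDyer.Theorems.GenusKolyTransp.twoTranspositionBitLaw_holds : TwoTranspositionBitLawAtTwo` (gk2-p4 g14, p671366
ACCEPTED, commit 7b89014c80e0, file `Summits/BirchSwinnertonDyer/BirchSwinnertonDyer/Theorems/GenusKolyvaginAtTwoGenusPrimitiveSupplyAtTwoTwoTranspositionBitLaw.lean`,
std axioms): `b q := [loc_{v_q} c_∞ ≠ 0]` for ONE class `c_∞ ∈ Sel^{rel ∞}₂(W) ∖ Sel₂(W)` (`[Sel^{rel ∞} : Sel₂] = #𝓛_∞ = 2` by gk2-p5's archimedean Kummer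
count, PT inputs discharged; `Sel₂(W)` strict at `∞` under `¬ MeetsEgg`), then the quadratic iff + a 16-case `Xor` check; consumers feed
`(hB : TwoTranspositionBitLawAtTwo)` (e.g. `not_trivial_of_closed hB` below) with `twoTranspositionBitLaw_holds`.  T-2q `TwoTranspositionTwistLawAtTwo`:
the QUADRATIC `iff` of (a) is KERNEL in frame currency — `…GenusKolyTransp.twoTranspositionTwistLaw_iff_strict` /
`…twoTranspositionTwistLaw_iff_strict_relaxedAtInfinity` (gk2-p4 g14, p669774, file `…TwoTranspositionIff.lean`: under T-2q's binders and a door open at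
`q₀` or `q₁`, `twistSelmerTwoCard W d = 1 ↔ selmerGroupRelaxedAtInfinityAtTwo W ⊓ ker loc_{v₀} ⊓ ker loc_{v₁} = ⊥`, Poonen–Rains at `T = {∞, v₀, v₁}` over
the plane algebra p668747), and T-2q VERBATIM follows from the one-place dictionary «`c ∈ twistCondAbove W χ qᵢ ↔ loc_{vᵢ} c = 0`» by
`…GenusKolyTransp.twoTranspositionTwistLawAtTwo_of_dictionary` (gk2-p4 g14, IN FLIGHT at the time of this note — check `lean search` before citing).
So of this file's rows: (a).1 + (b) counting KERNEL (p662416), bit law KERNEL (p671366), (a) quadratic iff KERNEL in frame currency (p669774) and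
verbatim modulo the dictionary; `TwoTranspositionSupplyAtTwo` (C′), `TwoTranspositionIndexLawAtTwo`, `TwoTranspositionTwistValueAtTwo` unchanged.
REF2 (g40, 21:27:41Z / 21:54:52Z ack): KNOWN-type IN-PRINT ASSEMBLY ([cite: MazurRubin2010, Lemma 3.2, method of Prop. 3.3]; [cite: PoonenRains2012, Thm. 4.14, Prop. 4.11];
[cite: KlagsbrunMazurRubin2014, Prop. 47 (ii)]); kernel-new; beyond-print theorem: no.  PARTITION: none; BSD not proved; no item closed (crux 22136 open at (U) ∧ (CONV₂)).
-/


noncomputable section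

open scoped Classical

namespace Summit.BirchSwinnertonDyer.Rank1Residual.F1Sign2.TwoDoor

open Literature.NumberTheory.EllipticCurves Literature.NumberTheory.EllipticCurves.ModularForms
  Summit.BirchSwinnertonDyer.Rank1Residual.F1Sign2
  Summit.BirchSwinnertonDyer.Rank1Residual.F1Sign2.TranspositionDoor
  NumberField IsDedekindDomain

set_option autoImplicit false

/-- **Two-transposition-admissible Heegner twist parameter at `Δ > 0`.**  `d < 0` squarefree, `d ≡ 1 (mod 8)`;
`q₀ ≠ q₁` are primes dividing `d`, of good reduction, at which Frobenius acts on `W[2]` as a transposition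
(`(Δ_min/q) = −1`); every other prime `q ∣ d` is good with `a_q(W)` odd (3-cycle: `H¹(ℚ_q, W[2]) = 0`); `d` is a square
modulo every odd bad prime (Heegner hypothesis; `W^{(d)} ≅ W` over `ℚ_ℓ`, `ℓ ∣ 2N`).  By AN-22J such `d` exist only when
`Δ_W > 0` (even number of transposition primes). [cite: MazurRubin2010, Def 3.1; Prop 3.3 cited for the METHOD only — its real-place hypothesis fails for d < 0 (REF2 v17 §9.1)] [cite: KlagsbrunMazurRubin2014, Prop. 47 (ii) and Rem. 50 (arXiv:1303.6507; Σ ∋ ∞)] -/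
def TwoTranspAdmissible (W : WeierstrassCurve ℚ) [W.IsGloballyMinimal] (d : ℤ) (q₀ q₁ : ℕ) : Prop :=
  d < 0 ∧ Squarefree d ∧ d % 8 = 1 ∧ q₀.Prime ∧ q₁.Prime ∧ q₀ ≠ q₁ ∧ (q₀ : ℤ) ∣ d ∧ (q₁ : ℤ) ∣ d ∧
    jacobiSym W.Δ.num q₀ = -1 ∧ jacobiSym W.Δ.num q₁ = -1 ∧
    (∀ q : ℕ, q.Prime → (q : ℤ) ∣ d →
      (∀ _h : Fact q.Prime, W.HasGoodReductionAtPrime q) ∧ (q ≠ q₀ → q ≠ q₁ → Odd (W.frobeniusTrace q))) ∧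
    (∀ ℓ : ℕ, ℓ.Prime → ℓ ≠ 2 → (∀ _h : Fact ℓ.Prime, ¬ W.HasGoodReductionAtPrime ℓ) → jacobiSym d ℓ = 1)

/-- The identity-component locus with odd Tamagawa product (`ε = −1`; the third locus of the line next to `OnEggLocus` and
`OnNegLocus`): `Δ > 0`, `E(ℚ)[2] = 0`, `Ш(E)[2] = 0`, `E(ℚ) ⊂ E⁰(ℝ)`, `∏ c_ℓ` odd. -/
def OnIdLocus (W : WeierstrassCurve ℚ) [W.IsElliptic] : Prop :=
  0 < W.Δ ∧ NoRationalTwoTorsion W ∧ ShaTwoTrivial W ∧ ¬ MeetsEgg W ∧ ¬ 2 ∣ W.tamagawaProduct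

/-- The twisted (`A_χ = W^{(d)}`) `2`-Selmer local condition above the rational prime `q`, read on `H¹(ℚ, W[2])`
(tree `PrimeTwist.selmerLocalKer`, MR 2007 Def 4.3, at the places `v ∣ q`). -/
def twistCondAbove (W : WeierstrassCurve ℚ) (χ : Field.absoluteGaloisGroup ℚ →ₜ* Multiplicative (ZMod 2)) (q : ℕ) :
    AddSubgroup (W.galH1Torsion ((2 : ℕ) : ℤ)) :=
  ⨅ (v : HeightOneSpectrum (𝓞 ℚ)) (_ : ((q : ℤ) : 𝓞 ℚ) ∈ v.asIdeal), PrimeTwist.selmerLocalKer W χ (v.adicCompletion ℚ)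

/-- **T-2q `TwoTranspositionTwistLawAtTwo` (THEOREM on paper — see the module docstring for the in-print assembly).**
Rank one, `Δ > 0`, `E(ℚ)[2] = 0`, `Ш[2] = 0`, `E(ℚ) ⊂ E⁰(ℝ)`; `(d, q₀, q₁)` two-transposition-admissible, `χ` the character
of `ℚ(√d)`.  (a) A door open at `q₀` or `q₁`: `#Sel₂(W^{(d)}) ∈ {1, 4}`, and `Sel₂(W^{(d)}) = 0` iff NO non-zero class of the
∞-relaxed Selmer group `R` of `W` satisfies the twisted local conditions above `q₀` and `q₁` (for `c ∈ R` these are the STRICT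
conditions `loc_{q_i} c = 0`, by transversality `H¹_f ∩ H¹_f^{(d)} = 0` at a ramified transposition prime).  (b) Both doors
closed: `#Sel₂(W^{(d)}) ∈ {4, 16}`.  Why it might fail: only through a slip in identifying `R ∩ Sel₂(W^χ)` (the isotropy
of `loc_∞ c_∞` for the Poonen–Rains form is what puts `c_∞` inside the twisted condition at `∞`).
[cite: MazurRubin2010, Lemma 3.2 at T = {∞, q₀, q₁} (Prop 3.3 = arXiv:0904.3709 Prop. 28 is cited for the METHOD only: its clause «all real places v with (Δ_E)_v > 0 split in F/K» is NOT met for d < 0 — REF2 v17 §9.1, REF1 §69 A2)] [cite: KlagsbrunMazurRubin2014, Prop. 47 (ii), Rem. 50 (arXiv:1303.6507; p = 2 ⟺ S₃, Σ ∋ ∞; applied at q₀ then q₁ — REF2 v17 §5)] LANDING NOTE (-ty g12, 2026-08-28): the COUNTING HALF is PROVED in the kernel —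
`Summit.BirchSwinnertonDyer.BirchSwinnertonDyer.Theorems.GenusKolyTransp.twoTranspositionTwistLaw_card`
(`Theorems/GenusKolyvaginAtTwoGenusPrimitiveSupplyAtTwoTwoTranspositionCount.lean`, bsd-line-gk2-p4 g13, p662416 ACCEPTED, commit fab9d926fb38; std axioms):
clause (a).1 «a door open at q₀ or q₁ ⟹ #Sel₂(W^{(d)}) ∈ {1, 4}» and clause (b) «both doors shut ⟹ #Sel₂(W^{(d)}) ∈ {4, 16}» — sandwich at T = {∞, q₀, q₁}
for ONE framed identification (transversal lines at all three places): elementary bound #Sel₂(W^d) ≤ 8·#S_T, Kramer parity ⟹ square, Kummer reading ⟹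
S_T = 0 (door open), Sel₂(W) ⊂ Sel₂(W^d) (doors shut).  NOT yet in the kernel: the quadratic `iff` of clause (a) («Sel₂(W^d) = 0 ⟺ R ∩ twisted conditions = ⊥»,
Poonen–Rains; needs a `PrimeTwist.selmerLocalKer`/`selmerGroupRelaxedAtInfinityAtTwo` ↔ `kummerSelmerStructure` dictionary + a PT count with a REAL T-place) —
so this `def` as a WHOLE is not yet a theorem; consumers of the counting clauses alone can use `twoTranspositionTwistLaw_card` by name.
[cite: PoonenRains2012, Thm 4.14 and Prop 4.11] [cite: KlagsbrunMazurRubin2013, §3] -/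
def TwoTranspositionTwistLawAtTwo : Prop :=
  ∀ (W : WeierstrassCurve ℚ) [W.IsElliptic] [W.IsGloballyMinimal] [W.IsIntegral ℤ], 0 < W.Δ → NoRationalTwoTorsion W →
    W.mordellWeilRank = 1 → ShaTwoTrivial W → ¬ MeetsEgg W →
    ∀ (d : ℤ) (q₀ q₁ : ℕ) [Fact q₀.Prime] [Fact q₁.Prime] (χ : Field.absoluteGaloisGroup ℚ →ₜ* Multiplicative (ZMod 2)),
      TwoTranspAdmissible W d q₀ q₁ → IsQuadraticCharacterOf χ d →
      ((MeetsNonNormAt W q₀ ∨ MeetsNonNormAt W q₁) →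
          (twistSelmerTwoCard W d = 1 ∨ twistSelmerTwoCard W d = 4) ∧
          (twistSelmerTwoCard W d = 1 ↔
            selmerGroupRelaxedAtInfinityAtTwo W ⊓ twistCondAbove W χ q₀ ⊓ twistCondAbove W χ q₁ = ⊥)) ∧
      (¬ MeetsNonNormAt W q₀ → ¬ MeetsNonNormAt W q₁ → twistSelmerTwoCard W d = 4 ∨ twistSelmerTwoCard W d = 16)

/-- **`TwoTranspositionBitLawAtTwo` (THEOREM on paper, the elementary shadow of T-2q; the census dictionary).**  For each curve
on the `ε = −1` locus there is ONE predicate `b` on primes (the local bits of `c_∞`, up to the global flip `b ↦ b + p`) such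
that for EVERY two-transposition-admissible `(d, q₀, q₁)`: `Sel₂(W^{(d)}) = 0 ⟺ exactly one of «door open at `q₀` and `b q₁`»,
«door open at `q₁` and `b q₀`» holds (`p_{q₀} b_{q₁} + p_{q₁} b_{q₀} = 1` over `𝔽₂`; both doors closed ⇒ never trivial).
Corollaries free of `b`: with `q₀` open and `q₁` closed, triviality depends on `q₁` alone; among the three pairwise twists of
three open primes an even number are trivial; the cofactor of 3-cycle primes is irrelevant.  Census ENGINE J pilot j297987:
12/12 curves consistent, rank `#T₁ − 1 = 7`, 441 independent redundant predictions met, 0 failed.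
[cite: MazurRubin2010, Lemma 3.2 (method of Prop 3.3; REF2 v17 §9.1)] [cite: KlagsbrunMazurRubin2014, Prop. 47 (ii) (arXiv:1303.6507)] [cite: PoonenRains2012, Thm 4.14] -/
def TwoTranspositionBitLawAtTwo : Prop :=
  ∀ (W : WeierstrassCurve ℚ) [W.IsElliptic] [W.IsGloballyMinimal] [W.IsIntegral ℤ], 0 < W.Δ → NoRationalTwoTorsion W →
    W.mordellWeilRank = 1 → ShaTwoTrivial W → ¬ MeetsEgg W →
    ∃ b : ℕ → Prop, ∀ (d : ℤ) (q₀ q₁ : ℕ) [Fact q₀.Prime] [Fact q₁.Prime], TwoTranspAdmissible W d q₀ q₁ →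
      (twistSelmerTwoCard W d = 1 ↔ Xor (MeetsNonNormAt W q₀ ∧ b q₁) (MeetsNonNormAt W q₁ ∧ b q₀))

/-- **`TwoTranspositionSupplyAtTwo` (THEOREM on paper: Mazur–Rubin 2010 Lemma 3.5 + Chebotarev + T-2q) — REPAIRED FORM C′ of REF1-AUDIT-v1 §69:
the binder `¬ IsSquare W.Δ →` (= Mazur–Rubin 2010 Lemma 3.5's printed hypothesis «Gal(M/K) ≅ S₃», arXiv:0904.3709 p. 8; equivalently
`W.HasSurjectiveModNGaloisRep 2`, tree bridge `WeierstrassCurve.not_isSquare_Δ_of_hasSurjectiveModNGaloisRep_two`) is INSERTED after `0 < W.Δ →`.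
As first typed (without it) the statement was REFUTED-MISSTATED: on a square-discriminant (`C₃`-image) curve no odd prime is a transposition prime,
so `TwoTranspAdmissible W d q₀ q₁` is empty (REF1 kernel lemma `REF1b69.not_twoTranspAdmissible_of_isSquare`), while the `ε = −1` rank-one
locus DOES contain such curves — 86 Cremona witnesses `N < 6·10⁴` (rank 1, odd torsion, `Δ_min = m² > 0`, generator on the identity component,
`Ш_an` odd), simplest **6156e1** `[0,0,0,−21,17]` (`Δ = 684²`); 74 of them are ENGINE J's own «0 transposition primes» rows. The witnesses miss C′;
REF1's `supplyS3_of_supply` shows nothing proved from the unrepaired form is lost; the crux `RankOneAtTwoBigImageOddLocal` carries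
`∀ n, W.HasSurjectiveModNGaloisRep (2^n)`, so the repair costs line `egg_kolyvagin_two` nothing (its `S_door` already derives `¬ IsSquare` from `hsurj 1`).**
On the rank-one `ε = −1` locus WITH `S₃` IMAGE MOD 2 there are an imaginary quadratic `K` with `(d_K, N) = 1` satisfying the Heegner hypothesis and two
transposition primes `q₀ ≠ q₁ ∣ d_K` with `(d_K, q₀, q₁)` two-transposition-admissible and `Sel₂(W^{(d_K)}) = 0`.
(Choose `q₀` with Frobenius a 4-cycle on `½P₀` and a transposition in the `S₄`-field of `c_∞`, `q₁` the other way round — or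
any pair with `p_{q₀} b_{q₁} + p_{q₁} b_{q₀} = 1` — residues fixed in `M K^{ab}`; the two `S₄`-fields over `M = ℚ(E[2])`
are distinct, hence disjoint over `M`.)  Why it might fail: only via the disjointness bookkeeping when `ρ_{E,4}` is small
(excluded on the big-image slice).  [cite: MazurRubin2010, Lemma 3.5 and Prop 3.3] -/
def TwoTranspositionSupplyAtTwo : Prop :=
  ∀ (W : WeierstrassCurve ℚ) [W.IsElliptic] [W.IsGloballyMinimal] [NeZero (W.conductorNorm ℤ)],
    0 < W.Δ → ¬ IsSquare W.Δ → NoRationalTwoTorsion W → W.mordellWeilRank = 1 → ShaTwoTrivial W → ¬ MeetsEgg W →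
    ∃ (K : Type) (_ : Field K) (_ : NumberField K) (q₀ q₁ : ℕ),
      IsImaginaryQuadratic K ∧ TwoTranspAdmissible W (NumberField.discr K) q₀ q₁ ∧
      twistSelmerTwoCard W (NumberField.discr K) = 1 ∧
      Nat.Coprime (NumberField.discr K).natAbs (W.conductorNorm ℤ) ∧
      SatisfiesHeegnerHypothesis (W.conductorNorm ℤ) K

/-- **AN-26 `TwoTranspositionIndexLawAtTwo` (CONJECTURE of this lens at `ε = −1`; the BSD₂-shadow).**  Rank one,
`E(ℚ)[2] = 0`, `Ш(E)[2] = 0`, `Δ > 0`, `E(ℚ) ⊂ E⁰(ℝ)`, `∏ c_ℓ` odd; `K` imaginary quadratic with `(d_K, q₀, q₁)`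
two-transposition-admissible AND `Sel₂(E^{(d_K)}) = 0`; a modular parametrisation datum with ODD constant and `P ∈ E(K)`
mapping to its complex Heegner point.  Then `P` is twice a point of `E(K)` up to torsion, and that half is NOT twice up to
torsion: `v₂ I_K = 1` exactly.  Through the tree door `P2.bsdp_two_iff_of_heegner_rankOne` (`n_∞ = 2`, `k = 1` since
`E(K)[2] = 0`, `w_K = 2`, `t_W`, `t_K`, `c` odd, `|u| = 1`, `v₂ q_{d} = v₂ ∏c_ℓ + 2` by T-2q + the twist value law) this is
EQUIVALENT to `BSD₂(E)` for such `E`; `Ш(E/K)[2] ≅ (ℤ/2)²` (Kramer 1981 Thm 1: `i_∞ = i_{q₀} = i_{q₁} = 1`, `Φ = 0`) is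
matched by `I_K² = 4·odd`.  Why it might fail: it is the 2-part of BSD in a corner where no Kolyvagin-system structure
theorem is in print, and the «exactly once divisible» shape is sensitive to any unaccounted factor `2` in the Gross–Zagier
bookkeeping with two additive primes.  Census ENGINE J tranche V (Ш_an(E^{(d)}) = 1 on all Sel-trivial rows of the pilot) and
P-22-type identity; ENGINE H rows asked from -data (two engines).
[cite: GrossLMS1991, Conj. 1.2 and §3] [cite: GrossZagier1986, V.§2] [cite: Kramer1981, Thm. 1] [cite: MazurRubin2010, Lemma 3.2 (method of Prop 3.3; REF2 v17 §9.1)] [cite: KlagsbrunMazurRubin2014, Prop. 47 (ii) (arXiv:1303.6507)] -/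
@[conjecture] def TwoTranspositionIndexLawAtTwo : Prop :=
  ∀ (W : WeierstrassCurve ℚ) [W.IsElliptic] [W.IsGloballyMinimal] [NeZero (W.conductorNorm ℤ)],
    W.mordellWeilRank = 1 → 0 < W.Δ → NoRationalTwoTorsion W → ShaTwoTrivial W → ¬ MeetsEgg W →
    ¬ 2 ∣ W.tamagawaProduct →
    ∀ (q₀ q₁ : ℕ) (K : Type) [Field K] [NumberField K], IsImaginaryQuadratic K →
      TwoTranspAdmissible W (NumberField.discr K) q₀ q₁ → twistSelmerTwoCard W (NumberField.discr K) = 1 →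
      ∀ (Dt : ModularParametrizationData W (W.conductorNorm ℤ))
        (H : HeegnerDatum (W.conductorNorm ℤ) (NumberField.discr K)) (ι : K →+* ℂ)
        (P : (W.baseChange K).toAffine.Point),
        WeierstrassCurve.Affine.Point.map ι.toRatAlgHom P = heegnerPointComplex Dt H →
        ¬ (2 : ℤ) ∣ Dt.c →
        ∃ Q : (W.baseChange K).toAffine.Point,
          P - 2 • Q ∈ AddCommGroup.torsion (W.baseChange K).toAffine.Point ∧ NotTwiceUpToTorsion W K Q

/-- **`TwoTranspositionTwistValueAtTwo` (2-part of BSD for the rank-0, `Sel₂`-trivial two-transposition twist; OPEN IN PRINT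
— two additive primes of type `I₀*` with `c_q = 2`, `a_q` even).**  In the door's currency `q_d = L(E^{(d)},1)/Ω(E^{(d)}_min)`:
`v₂ q_d = v₂ ∏c_ℓ(E) + 2`.  Nearest print IN the regime (REF2 v17 §5): Zhai 2021 Thm 1.1 gives the LOWER BOUND `ord₂(L(E^{(d)},1)/c_∞(E^{(d)})) ≥ t_E(d) − 1 − ord₂ν_E = 1` here (`t_E(d) = 2`; `E` optimal, `4 ∤ N` ⇒ `ν_E` odd), against the predicted `v₂Tam(E) + 2 ≥ 2`; the equality is OPEN. [cite: Zhai2021BSDExactFormulaTwists, Thm 1.1 (arXiv:2102.11798 p. 3)]  Census ENGINE J tranche V: `Ш_an(E^{(d)}) = 1` and `v₂ Tam(E^{(d)}) = v₂ Tam(E) + 2` on every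
Sel-trivial row of the pilot.  [cite: Zhai2016, Thm 1.1] [cite: KrizLi2019, Thm 5.1] [cite: CaiLiZhai2019, Thm 1.1] -/
@[conjecture] def TwoTranspositionTwistValueAtTwo : Prop :=
  ∀ (W : WeierstrassCurve ℚ) [W.IsElliptic] [W.IsGloballyMinimal], 0 < W.Δ → NoRationalTwoTorsion W →
    W.mordellWeilRank = 1 → ShaTwoTrivial W → ¬ MeetsEgg W →
    ∀ (d : ℤ) (q₀ q₁ : ℕ), TwoTranspAdmissible W d q₀ q₁ → twistSelmerTwoCard W d = 1 →
      ∀ (Wd : WeierstrassCurve ℚ) [Wd.IsElliptic] [Wd.IsGloballyMinimal] (Cd : WeierstrassCurve.VariableChange ℚ),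
        Cd • W.quadraticTwist (d : ℚ) = Wd →
        ∃ qd : ℚ, Wd.entireLFunction 1 / (Wd.realPeriodRat : ℂ) = (qd : ℂ) ∧ qd ≠ 0 ∧
          padicValRat 2 qd = padicValNat 2 W.tamagawaProduct + 2

/-- Sanity (proved): a two-transposition-admissible triple has `d < 0` and two distinct primes `q₀, q₁ ∣ d` — the datum is not
vacuous by shape; inhabited instance `(446a1, d = −95, q₀ = 5, q₁ = 19)` (pilot j297987: `Sel₂(E^{(−95)}) = 0`, `Ш_an = 1`). -/
theorem twoTranspAdmissible_neg {W : WeierstrassCurve ℚ} [W.IsGloballyMinimal] {d : ℤ} {q₀ q₁ : ℕ}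
    (h : TwoTranspAdmissible W d q₀ q₁) : d < 0 ∧ q₀.Prime ∧ q₁.Prime ∧ q₀ ≠ q₁ ∧ (q₀ : ℤ) ∣ d ∧ (q₁ : ℤ) ∣ d :=
  ⟨h.1, h.2.2.2.1, h.2.2.2.2.1, h.2.2.2.2.2.1, h.2.2.2.2.2.2.1, h.2.2.2.2.2.2.2.1⟩

/-- Bookkeeping (proved): the bit law decides triviality WITHOUT `b` when both doors are closed (never trivial) — the
`(0,0)` row of Mazur–Rubin's table. -/
theorem not_trivial_of_closed (hB : TwoTranspositionBitLawAtTwo)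
    (W : WeierstrassCurve ℚ) [W.IsElliptic] [W.IsGloballyMinimal] [W.IsIntegral ℤ]
    (hΔ : 0 < W.Δ) (h2 : NoRationalTwoTorsion W) (hr : W.mordellWeilRank = 1) (hS : ShaTwoTrivial W) (hε : ¬ MeetsEgg W)
    (d : ℤ) (q₀ q₁ : ℕ) [Fact q₀.Prime] [Fact q₁.Prime] (hadm : TwoTranspAdmissible W d q₀ q₁)
    (h0 : ¬ MeetsNonNormAt W q₀) (h1 : ¬ MeetsNonNormAt W q₁) : twistSelmerTwoCard W d ≠ 1 := by
  obtain ⟨b, hb⟩ := hB W hΔ h2 hr hS hε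
  intro htriv
  have hx := (hb d q₀ q₁ hadm).mp htriv
  rcases hx with ⟨⟨hq0, -⟩, -⟩ | ⟨⟨hq1, -⟩, -⟩
  · exact h0 hq0
  · exact h1 hq1

end Summit.BirchSwinnertonDyer.Rank1Residual.F1Sign2.TwoDoor

end
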